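import Summits.ResolutionOfSingularities.ResolutionOfSingularities.Theorems.EquisingularLiftEquisingularLiftNatNoPureNoseNormalS1
import Literature.AlgebraicGeometry.Resolution.FiniteNormalizationCompleteLocalBase
import Mathlib.RingTheory.FiniteType
import HarnessLib

/-!
# [OURS · L1 W4.5(b) · EL♮] (V-2) NO-PURE-NOSE spine ‖ K·F-106: the normalisation of a finite-type domain over a complete DVR has no
# embedded primes in its special fibre (memo steps (5)+(6) at ring level: F-106 Nagata finiteness + F-(V)b S₂)
# (crux `EquisingularLiftNat` = stmt-ResolutionOfSingularities-20038; PARENT ≥ 4 band / kill test #50 K5-BMY, PURE column)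

HONEST FRAMING. OURS (cell res-hironaka, crux chain w45b, slot W4.5(b)); NOT a statement of any manuscript; AI-written, AI review is
weaker than expert review. Helper `--supports stmt-ResolutionOfSingularities-20038 --as helper`. Object «(V) NO-PURE-NOSE», piece (V-2),
consuming the NAMED FACT **F-106** = `Literature.AlgebraicGeometry.Resolution.EGAIV2_7_7_4_finiteNormalization_completeLocal` (EGA IV₂
Cor. (7.7.4): a complete Noetherian local ring is universally Japanese; typed by res-lit-6 g20, p573655, res-dag-4 F-106 RESERVED
2026-08-27T21:35:35Z) BY NAME as a hypothesis `(hN : …)` — label «‖ K·F-106»: the theorems below are CONDITIONAL on that published fact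
and become unconditional when `…_holds` lands.

* `height_eq_one_of_mem_associatedPrimes_normalization` — `O` a complete DVR, `A` an `O`-algebra of finite type and a domain,
  `Ā := integralClosure A (Frac A)` its normalisation (finite over `A` by F-106, hence Noetherian; integrally closed; a domain),
  `a ∈ Ā` nonzero (e.g. the uniformiser `ϖ`): every associated prime of `Ā ⧸ (a)` has height `1` —
  `…NatNoPureNoseNormalS1.height_eq_one_of_mem_associatedPrimes_quotient_span_singleton` (F-(V)b, ‖ K) applied to `Ā`.
* `mem_minimalPrimes_of_mem_associatedPrimes_normalization` — hence NO EMBEDDED primes: `(S̃^ν)_s = S̃^ν ⧸ ϖ` is `S₁`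
  (memo NO-PURE-NOSE §1 step (6), for the affine rings of `S̃^ν`).

References: A. Grothendieck, J. Dieudonné, EGA IV₂ (1965), Cor. (7.7.4) [EGAIV2]; H. Matsumura, *Commutative Ring Theory* (1986),
Thm. 11.5 [Matsumura1987]; tree `…Resolution/FiniteNormalizationCompleteLocalBase.lean` (F-106), `…NatNoPureNoseNormalS1` (p573205).
-/

set_option linter.dupNamespace false -- mandated namespace `Summit.<Summit>.<Problem>` of this single-conjunct summit

noncomputable section

universe u

open IsLocalRing
open Literature.AlgebraicGeometry.Resolution

namespace Summit.ResolutionOfSingularities.ResolutionOfSingularities.Cruxes.EquisingularLiftNat.Sections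

namespace NoPureNose

/-- **(V-2) ‖ K·F-106 — the special fibre of the normalisation has height-one associated primes.** For a complete DVR `O`, an
`O`-algebra `A` of finite type which is a domain, and `0 ≠ a ∈ Ā = integralClosure A (Frac A)`: every associated prime of `Ā ⧸ (a)` has
height `1`. CONDITIONAL on F-106 (`EGAIV2_7_7_4_finiteNormalization_completeLocal`, finiteness of `Ā` over `A`).
[cite: EGAIV2, Cor. (7.7.4)] [cite: Matsumura1987, Thm. 11.5] -/
theorem height_eq_one_of_mem_associatedPrimes_normalization
    (hN : EGAIV2_7_7_4_finiteNormalization_completeLocal.{u})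
    (O A : Type u) [CommRing O] [IsDomain O] [IsDiscreteValuationRing O] [IsAdicComplete (maximalIdeal O) O]
    [CommRing A] [IsDomain A] [Algebra O A] (hA : Algebra.FiniteType O A)
    {a : integralClosure A (FractionRing A)} (ha : a ≠ 0)
    {𝔔 : Ideal (integralClosure A (FractionRing A))}
    (h𝔔 : 𝔔 ∈ associatedPrimes (integralClosure A (FractionRing A))
      (integralClosure A (FractionRing A) ⧸ Ideal.span {a})) :
    𝔔.height = 1 := by
  haveI : Module.Finite A (integralClosure A (FractionRing A)) := hN.completeDVR O A hA
  haveI : IsNoetherianRing A := Algebra.FiniteType.isNoetherianRing O A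
  haveI : IsNoetherianRing (integralClosure A (FractionRing A)) :=
    IsNoetherianRing.of_finite A (integralClosure A (FractionRing A))
  haveI : IsIntegrallyClosed (integralClosure A (FractionRing A)) :=
    integralClosure.isIntegrallyClosedOfFiniteExtension (R := A) (FractionRing A) (L := FractionRing A)
  exact height_eq_one_of_mem_associatedPrimes_quotient_span_singleton ha h𝔔

/-- **Hence `Ā ⧸ (a)` has NO EMBEDDED primes** (`S₁`): every associated prime is minimal over `(a)` — NO-PURE-NOSE §1 step (6) for the
affine rings of `S̃^ν`, ‖ K·F-106. [cite: EGAIV2, Cor. (7.7.4)] [cite: Matsumura1987, Thm. 11.5] -/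
theorem mem_minimalPrimes_of_mem_associatedPrimes_normalization
    (hN : EGAIV2_7_7_4_finiteNormalization_completeLocal.{u})
    (O A : Type u) [CommRing O] [IsDomain O] [IsDiscreteValuationRing O] [IsAdicComplete (maximalIdeal O) O]
    [CommRing A] [IsDomain A] [Algebra O A] (hA : Algebra.FiniteType O A)
    {a : integralClosure A (FractionRing A)} (ha : a ≠ 0)
    {𝔔 : Ideal (integralClosure A (FractionRing A))}
    (h𝔔 : 𝔔 ∈ associatedPrimes (integralClosure A (FractionRing A))
      (integralClosure A (FractionRing A) ⧸ Ideal.span {a})) :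
    𝔔 ∈ (Ideal.span {a}).minimalPrimes := by
  haveI : Module.Finite A (integralClosure A (FractionRing A)) := hN.completeDVR O A hA
  haveI : IsNoetherianRing A := Algebra.FiniteType.isNoetherianRing O A
  haveI : IsNoetherianRing (integralClosure A (FractionRing A)) :=
    IsNoetherianRing.of_finite A (integralClosure A (FractionRing A))
  haveI : IsIntegrallyClosed (integralClosure A (FractionRing A)) :=
    integralClosure.isIntegrallyClosedOfFiniteExtension (R := A) (FractionRing A) (L := FractionRing A)
  exact mem_minimalPrimes_of_mem_associatedPrimes_quotient_span_singleton ha h𝔔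

end NoPureNose

end Summit.ResolutionOfSingularities.ResolutionOfSingularities.Cruxes.EquisingularLiftNat.Sections
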